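import Summits.HubbardSuperconductivity.HubbardSuperconductivity.Theses.LiebTwin
import Summits.HubbardSuperconductivity.HubbardSuperconductivity.Theorems.NoGoNogoThesis
import Summits.HubbardSuperconductivity.HubbardSuperconductivity.Theorems.NoOnsiteODLRO.Negative.FalseWithoutGroundState
import Summits.HubbardSuperconductivity.HubbardSuperconductivity.Theorems.NoOnsiteODLRO.Negative.ShiftedInfraredBoundKernel
import Summits.HubbardSuperconductivity.HubbardSuperconductivity.Theorems.NoOnsiteODLRO.Negative.FreeEndpointTightness

/-!
# Disproof of `NoOnsiteODLRO` (stmt-HubbardSuperconductivity-0933; routes `LiebTwin`, `EnslavedA1g`) — findings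

Opened by the crux-attack refuter (`refuter-rattack-stmt-HubbardSuperconductivity-0933-0`, 2026-08-17 09:06Z);
EXTENDED by the crux disprover (`refuter-cdisprove-stmt-HubbardSuperconductivity-0933-0`, cycle 1, 2026-08-17 10:00Z:
"WHY IT RESISTS", section (d) on the picked line, formalisation audit). Later seats extend this file, never restart it.

VERDICT: **no kill — the crux survives** (stamped `check --elaborates true`); every negative result obtainable
WITHOUT explicit large-`L` ground states is landed (p149867, p153023, p154305), and the statement is refutation-proof for the
structural reason below.

## WHY IT RESISTS (cdisprove cycle 1)

A witness against the crux is a fixed `(U, δ) ∈ (0,∞)×(0,1/2)` and an admissible sequence of EXACT sector ground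
states `ψ_L` with `S_L ≥ εL⁴` for infinitely many even `L`.
1. No ground state of `hubbardTorus 2 L 1 U` with `U > 0` and density `1/2 < n < 1` is known in closed form at any
   `L ≥ 4`, and the conclusion `∀ ε ∃ L₀` absorbs every finite-`L` computation: neither algebra nor certified
   numerics can produce a witness (the only explicit in-sector states with macroscopic `S_L`, the `η₀`-towers, are
   not eigenvectors — that is exactly the landed load-bearing lemma of section (a)).
2. Physically a witness is an **A1g-paired repulsive ground state**: under a strict pair window the crux is
   EQUIVALENT to the absence of nearest-neighbour extended-`s` LRO (STRATEGY-CENSUS F1; both directions proved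
   from `enslavedA1gLowerSandwich_proof` / `a1gSlavingTransfer_proof`), i.e. "the whole A1g channel never
   condenses". The asymptotically exact weak-coupling solution at `t' = 0` selects `B1g` for `1 > n > 0.6` and
   `B2g` (`d_xy`) for `n < 0.6` (Raghu–Kivelson–Scalapino 2010, arXiv:1002.0591, p. 7 — read this cycle), and a
   `B1g`/`B2g` condensate has ZERO on-site amplitude by symmetry (degenerate multiplets are no loophole:
   `‖P_s ψ‖²` is convex over symmetry sectors, `P_s` being a `k = 0` singlet); at strong coupling on-site pairing is
   slaved to the bond-singlet channel at rate `(t/U)²` and no `t–J`/Hubbard study reports extended-`s` order for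
   `n ∈ (1/2, 1)`. No A1g window is known or suspected anywhere in the crux's range — nothing to aim at.
3. Parameter boundary: `U = 0` is TRUE (free shells: `S_L ≤ N_closed + g²/2 + g` with Fermi-shell multiplicity
   `g ≤ 2L` — closed-shell pair removals are orthogonal and contribute `N_closed`, the shell part is a pseudospin
   lowering of spin `≤ g/2` — so `S_L ≤ N_L + 2L² + 2L` for EVERY sector ground state); `δ → 0` is TRUE (Lieb uniqueness + Kubo–Kishi); `δ ≥ 1/2` and small `N`: TRUE; only `U < 0`
   is FALSE, and a Lean witness there IS the open attractive-Hubbard `s`-wave LRO problem.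
4. Formalisation audit (no junk handle): `hamiltonian = −t Σ_{ordered adjacent} c†c + U Σ n↑n↓` (plain form, so
   `[H, η_Q†] = U η_Q†`); `minEnergyOn` = `sInf` of the sector's Rayleigh values (finite-dimensional, attained);
   `IsGroundStateInSector` = membership ∧ `ψ ≠ 0` ∧ the eigen-equation AT `minEnergyOn`; `FermionTorus 2 0` is an
   empty type, so the `L = 0` conjunct of the hypothesis block is satisfied by the vacuum (non-vacuity below covers
   every `L`); `L⁴ > 0` under `NeZero`; `N_L = 2⌊(1−δ)L²/2⌋ ≤ L²`.

## Battery (crux-attack seat)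

* Elaboration: rc 0; the decl's body is `rfl`-equal to the spelled-out statement; the two route copies
  `Theses.LiebTwin.NoOnsiteODLRO` / `Theses.EnslavedA1g.NoOnsiteODLRO` are `Iff.rfl` (re-checked 2026-08-17 cycle 1).
* Triviality / cheap falsity by automation: `simp`, `aesop`, `exact?` close neither the crux nor its
  negation; `C → S` and `S → C` (restates-the-summit probes) fail — the crux is an `∀(U,δ)` s-wave CEILING,
  the summit an `∃(U,δ)` d-wave FLOOR.
* Vacuity: the hypothesis block (the summit's, verbatim) is satisfiable at every `(U, δ)` —
  `noOnsiteODLRO_hypotheses_nonvacuous` below (tree `NoGo.exists_groundStateInSector_seq`).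
* No finite falsifier exists: the conclusion is `∀ ε ∃ L₀ ∀ even L ≥ L₀`, so every finite-`L` pathology is
  absorbed; nothing to compute.
* Degenerate ground spaces are not a loophole: `P_s = pairField sWave L = -√2 η₀` is a `k = 0` spin singlet,
  so `‖P_s ψ‖²` of a superposition across symmetry sectors is a convex combination of the sector values.

## LOAD-BEARING ANALYSIS (section (a))

* `noOnsiteODLRO_false_without_groundState` (LANDED, p149867,
  `Theorems/NoOnsiteODLRO/Negative/FalseWithoutGroundState.lean`): drop ONLY the eigenvector equation
  `H ψ_L = E_{N_L} ψ_L` from `IsGroundStateInSector` (keep filling, normalisation, `ψ_L ∈ szSector N_L 0`,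
  `ψ_L ≠ 0`) and the crux is FALSE — witness the normalised UNSTAGGERED `η`-tower `(η₀†)^m |0⟩`
  (`etaPairingState 1 m`, `m = N_L/2`), an in-sector `k = 0` on-site pair condensate with
  `S_L = 2 m (L² - m + 1) > L⁴/8` at `δ = 1/4`. Restated here as `¬ NoOnsiteODLROWithoutGroundState`, and
  `noOnsiteODLRO_of_withoutGroundState` checks that the mutation is a genuine strengthening of the crux.
  MORAL: sector bookkeeping is powerless; only the spectral (bottom-of-sector) property of `ψ_L` can work, and
  the `η₀`-tower (energy `≈ mU + O(t)`-scale above the band bottom) is the extremiser any bound must exclude.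
* `0 < U`: NOT refutable by the endpoint — at `U = 0` the matrix is still TRUE on paper (free open shells:
  `S_L ≤ N_L + O(g²)`, `g` = shell degeneracy `≤ 2L`; formalisable from
  `WindowInfraredBound.free_eucNorm_modeSum_mulVec_le` with the constant s-wave mode coefficient — not done);
  the sign of `U` is needed only to exclude `U < 0`, where the statement is physically FALSE (s-wave BEC) but
  a Lean witness would BE the open attractive-Hubbard LRO problem (route LiebTwin's `AttractiveOnsiteLRO`).
* `δ ∈ (0,1/2)`, `Even L`: not load-bearing for truth (repulsion forbids on-site condensation at any filling /
  on odd tori as well, conjecturally); normalisation: trivially load-bearing (scaling).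

## TIGHTNESS / STRENGTHENINGS (section (b)/(c))

The natural quantitative strengthening `S_L = O(L²)` (summable on-site pair correlations) is what
`Lines/birth.lean`'s open stub `stub_shiftedInfraredBound` effectively needs (lead c1 ANALYSIS: the stub is
crux-sized); free fermions already saturate it — KERNEL-CHECKED (cdisprove cycle 1, LANDED p154305,
`Theorems/NoOnsiteODLRO/Negative/FreeEndpointTightness.lean`, restated in section (b') below): at the endpoint
`U = 0` the paired Fermi seas `Φ_F = Π_{k∈F} c†_{k↑}c†_{-k↓}|0⟩` are exact sector ground states with
`S_L = N_L` EXACTLY (`P_s = -√2 Σ_k b_k`, pair-removed seas orthonormal), for every `δ` an admissible free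
sequence with `S_L = N_L` at all `L ≥ 3` exists, and the strengthening (`0 ≤ U`, rate `S_L/L² → 0`) is FALSE —
so no rate better than `L²` can be asked of every ground state. The stub itself is sandwiched: [`S_L = O(L²)` ∧ strict window] ⇒ stub ⇒ `S_L = O(L^{8/3})`
(engine p146717), so it asks a POWER-LAW improvement over the crux's `o(L⁴)`; a ground state with
`L^{8/3} ≪ S_L ≪ L⁴` would satisfy the crux and violate the stub — again nothing constructible either way.

## LINE `registered` (`Lines/birth.lean`; section (d), cdisprove cycle 1)

The single open stub `stub_shiftedInfraredBound` (the `K₋`-form infrared bound, `∀ v ∈ szSector (N_L−2) 0`) is NOT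
refuted, but it is STRICTLY MORE EXPOSED than the crux: its `∀ v` quantifier silently asserts `P_s ψ_L ⊥ ker K₋` and
`⟨η φ, P_s ψ_L⟩ = 0` for every ground state `φ` of the sector, eventually (LANDED p153023,
`Theorems/NoOnsiteODLRO/Negative/ShiftedInfraredBoundKernel.lean`; restated below by name). The assertion bites
exactly on the CLOSED-window branch `E(N_L−2,0) = E(N_L,0) − U` (`closedWindow_iff_exists_zeroMode`; numerically
never seen — census ED j024247, `ηψ = 0` in 48/48) and is vacuous on the strict branch (`EtaVacuum`, p151740).
Repairs that keep the line honest: quantify `v` over `(ker K₋)ᗮ` (then the kernel component of `P_s ψ_L` needs its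
own `o(L⁴)` bound) or carry `StrictPairWindow` (census B4) as an explicit hypothesis.

-- Targets: `stub_shiftedInfraredBound` — not broken; exposure landed (p153023). No stuck stubs were handed over
(payload `stuck_stubs = []`). Near-misses: none that type-check short of a ground state.
-/

noncomputable section

set_option linter.dupNamespace false

namespace Summit.HubbardSuperconductivity.HubbardSuperconductivity.Cruxes.NoOnsiteODLRO.Disproof

open Matrix
open Literature.Probability.LatticeModels Literature.MathematicalPhysics.QuantumLattice
open Summit.HubbardSuperconductivity.HubbardSuperconductivity.Theses.LiebTwin (NoOnsiteODLRO)
open scoped ComplexOrder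

/-! ## (b) Non-vacuity of the hypothesis block -/

/-- The hypotheses of `NoOnsiteODLRO` are satisfiable at every `(U, δ)` with `δ > -1` (so at every point
of the crux's range): admissible normalised sector ground-state sequences exist
(tree `NoGo.exists_groundStateInSector_seq`). Lieb, PRL 62 (1989) 1201; Tasaki (2020) §2.2. [folklore] -/
theorem noOnsiteODLRO_hypotheses_nonvacuous (U δ : ℝ) (hδ : δ ∈ Set.Ioo (0 : ℝ) (1 / 2)) :
    ∃ (N : ℕ → ℕ) (ψ : ∀ L, Fock (Orb (FermionTorus 2 L))),
      ∀ L, Even L → N L = 2 * ⌊(1 - δ) * (L : ℝ) ^ 2 / 2⌋₊ ∧ star (ψ L) ⬝ᵥ ψ L = 1 ∧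
        IsGroundStateInSector (hubbardTorus 2 L 1 U) (N L) 0 (ψ L) := by
  obtain ⟨N, ψ, h⟩ := Summit.HubbardSuperconductivity.NoGo.exists_groundStateInSector_seq 1 U δ
    (by linarith [hδ.1])
  exact ⟨N, ψ, fun L _ => h L⟩

/-! ## (a) Load-bearing analysis: the eigenvector equation -/

/-- `NoOnsiteODLRO` with the eigenvector clause of `IsGroundStateInSector` dropped (sector membership and
`ψ_L ≠ 0` kept; everything else verbatim). [folklore] -/
def NoOnsiteODLROWithoutGroundState : Prop :=
  ∀ (U δ : ℝ), 0 < U → δ ∈ Set.Ioo (0 : ℝ) (1 / 2) →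
    ∀ (N : ℕ → ℕ) (ψ : ∀ L, Fock (Orb (FermionTorus 2 L))),
      (∀ L, Even L → N L = 2 * ⌊(1 - δ) * (L : ℝ) ^ 2 / 2⌋₊ ∧ star (ψ L) ⬝ᵥ ψ L = 1 ∧
          (ψ L ∈ szSector (Λ := FermionTorus 2 L) (N L) 0 ∧ ψ L ≠ 0)) →
        ∀ ε : ℝ, 0 < ε → ∃ L₀ : ℕ, ∀ (L : ℕ) [NeZero L], Even L → L₀ ≤ L →
          (expect ((pairField sWave L)ᴴ * pairField sWave L) (ψ L)).re / (L : ℝ) ^ 4 ≤ ε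

/-- The mutation is a genuine STRENGTHENING of the crux (it weakens the hypothesis on `ψ`):
`NoOnsiteODLROWithoutGroundState → NoOnsiteODLRO`. [folklore] -/
theorem noOnsiteODLRO_of_withoutGroundState : NoOnsiteODLROWithoutGroundState → NoOnsiteODLRO := by
  intro h U δ hU hδ N ψ hyp
  exact h U δ hU hδ N ψ fun L hL =>
    ⟨(hyp L hL).1, (hyp L hL).2.1, (hyp L hL).2.2.1, (hyp L hL).2.2.2.1⟩

/-- **Any proof must use the eigenvector equation**: the strengthened statement is FALSE (landed theorem
`Theorems.NoOnsiteODLRO.Negative.noOnsiteODLRO_false_without_groundState`, p149867; witness the normalised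
unstaggered `η`-tower, `S_L = 2m(L² - m + 1) > L⁴/8` at `δ = 1/4`).
Yang, PRL 63 (1989) 2144; Yang–Zhang, Mod. Phys. Lett. B 4 (1990) 759. [folklore] -/
theorem noOnsiteODLRO_false_without_groundState : ¬ NoOnsiteODLROWithoutGroundState :=
  Summit.HubbardSuperconductivity.HubbardSuperconductivity.Theorems.NoOnsiteODLRO.Negative.noOnsiteODLRO_false_without_groundState

/-! ## (b') Tightness at the endpoint `U = 0`: the `L²` law is attained (landed p154305) -/

/-- The strengthening of the crux by the closed endpoint and the free-fermion rate: `0 ≤ U` in place of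
`0 < U` and `S_L / L² → 0` in place of `S_L / L⁴ → 0` (everything else verbatim). [folklore] -/
def NoOnsiteODLRORateTwoNonneg : Prop :=
  ∀ (U δ : ℝ), 0 ≤ U → δ ∈ Set.Ioo (0 : ℝ) (1 / 2) →
    ∀ (N : ℕ → ℕ) (ψ : ∀ L, Fock (Orb (FermionTorus 2 L))),
      (∀ L, Even L → N L = 2 * ⌊(1 - δ) * (L : ℝ) ^ 2 / 2⌋₊ ∧ star (ψ L) ⬝ᵥ ψ L = 1 ∧
          IsGroundStateInSector (hubbardTorus 2 L 1 U) (N L) 0 (ψ L)) →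
        ∀ ε : ℝ, 0 < ε → ∃ L₀ : ℕ, ∀ (L : ℕ) [NeZero L], Even L → L₀ ≤ L →
          (expect ((pairField sWave L)ᴴ * pairField sWave L) (ψ L)).re / (L : ℝ) ^ 2 ≤ ε

/-- **Tightness witness** (landed, `Negative.exists_admissible_free_seq_onsitePairNumber_eq`): for every
`δ ∈ (0,1/2)` an admissible sequence of normalised FREE (`U = 0`) sector ground states — paired Fermi seas over
Fermi sets of `⌊(1-δ)L²/2⌋` band levels — with `S_L = N_L` EXACTLY at every `L ≥ 3`.
Yang, Rev. Mod. Phys. 34 (1962) 694, §3; BCS (1957) §II. [folklore] -/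
theorem exists_admissible_free_seq_onsitePairNumber_eq {δ : ℝ} (hδ : δ ∈ Set.Ioo (0 : ℝ) (1 / 2)) :
    ∃ (N : ℕ → ℕ) (ψ : ∀ L, Fock (Orb (FermionTorus 2 L))),
      (∀ L, N L = 2 * ⌊(1 - δ) * (L : ℝ) ^ 2 / 2⌋₊ ∧ star (ψ L) ⬝ᵥ ψ L = 1 ∧
          IsGroundStateInSector (hubbardTorus 2 L 1 0) (N L) 0 (ψ L)) ∧
        ∀ (L : ℕ) [NeZero L], 3 ≤ L →
          (expect ((pairField sWave L)ᴴ * pairField sWave L) (ψ L)).re = (N L : ℝ) :=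
  Summit.HubbardSuperconductivity.HubbardSuperconductivity.Theorems.NoOnsiteODLRO.Negative.exists_admissible_free_seq_onsitePairNumber_eq
    hδ

/-- **No rate below `L²`** (landed, `Negative.not_onsitePairNumber_littleO_sq_at_zero_coupling`): the
strengthening `NoOnsiteODLRORateTwoNonneg` is FALSE (the free paired-sea sequence at `δ = 1/4` has
`S_L / L² = N_L / L² → 3/4`). The crux's `o(L⁴)` and the line's `O(L^{8/3})` sit strictly between the free
value `L²` and the trivial `L⁴`; at `U > 0` nothing below `L⁴` is known for every ground state. [folklore] -/
theorem not_noOnsiteODLRORateTwoNonneg : ¬ NoOnsiteODLRORateTwoNonneg :=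
  Summit.HubbardSuperconductivity.HubbardSuperconductivity.Theorems.NoOnsiteODLRO.Negative.not_onsitePairNumber_littleO_sq_at_zero_coupling

/-! ## (d) Targets — line `registered` (`Lines/birth.lean`): the open stub `stub_shiftedInfraredBound` -/

/-- The line's single open stub, restated VERBATIM (body = `Lines/birth.lean: stub_shiftedInfraredBound`):
the `U`-shifted variational infrared bound, with the `K₋`-form `Re⟨v, H v⟩ + (U − E(N_L,0))‖v‖²`
(`K₋ = H − E(N_L,0) + U ≥ 0` on the pair-removed sector) on the right and ALL `v` of `szSector (N_L − 2) 0`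
on the left. Kubo–Kishi, PRB 41 (1990) 4866, Thm 2 (the bound being transplanted). [folklore] -/
def StubShiftedInfraredBound : Prop :=
  ∀ (U δ : ℝ), 0 < U → δ ∈ Set.Ioo (0 : ℝ) (1 / 2) →
    ∀ (N : ℕ → ℕ) (ψ : ∀ L, Fock (Orb (FermionTorus 2 L))),
      (∀ L, Even L → N L = 2 * ⌊(1 - δ) * (L : ℝ) ^ 2 / 2⌋₊ ∧ star (ψ L) ⬝ᵥ ψ L = 1 ∧
          IsGroundStateInSector (hubbardTorus 2 L 1 U) (N L) 0 (ψ L)) →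
        ∃ C : ℝ, 0 ≤ C ∧ ∃ L₀ : ℕ, ∀ (L : ℕ) [NeZero L], Even L → L₀ ≤ L →
          ∀ v : Fock (Orb (FermionTorus 2 L)), v ∈ szSector (Λ := FermionTorus 2 L) (N L - 2) 0 →
            ‖star v ⬝ᵥ ((pairField sWave L) *ᵥ (ψ L))‖ ^ 2 ≤
              C * (L : ℝ) ^ 2 *
                ((expect (hubbardTorus 2 L 1 U) v).re +
                  (U - (hubbardTorus 2 L 1 U).minEnergyOn (szSector (Λ := FermionTorus 2 L) (N L) 0)) *
                    (star v ⬝ᵥ v).re)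

/-- **HIDDEN ASSERTION of the stub** (landed p153023, `Negative.shiftedInfraredBound_forces_kernel_orthogonality`):
along every admissible sequence the stub forces, eventually in even `L`, (i) `P_s ψ_L ⊥ ker K₋` — every zero mode
`v` of `K₋ = H − E(N_L,0) + U` in the pair-removed sector has `⟨v, P_s ψ_L⟩ = 0` (the right-hand side vanishes
there, so NO prefactor absorbs an overlap) — and (ii) `⟨η φ, P_s ψ_L⟩ = 0` for EVERY ground state `φ` of the same
sector (`η φ`, `η = etaLower torusStagger`, is such a zero mode by the adjoint Yang relation). Both are vacuous on
the strict-window branch (`Negative.zeroMode_eq_zero_of_strictWindow`; `η φ = 0` by `EtaVacuum`, p151740) and are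
genuine constraints on the unknown ground states on the closed branch. Yang, PRL 63 (1989) 2144. [folklore] -/
theorem stubShiftedInfraredBound_forces_kernel_orthogonality (h : StubShiftedInfraredBound) :
    ∀ (U δ : ℝ), 0 < U → δ ∈ Set.Ioo (0 : ℝ) (1 / 2) →
      ∀ (N : ℕ → ℕ) (ψ : ∀ L, Fock (Orb (FermionTorus 2 L))),
        (∀ L, Even L → N L = 2 * ⌊(1 - δ) * (L : ℝ) ^ 2 / 2⌋₊ ∧ star (ψ L) ⬝ᵥ ψ L = 1 ∧
            IsGroundStateInSector (hubbardTorus 2 L 1 U) (N L) 0 (ψ L)) →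
          ∃ L₀ : ℕ, ∀ (L : ℕ) [NeZero L], Even L → L₀ ≤ L →
            (∀ v : Fock (Orb (FermionTorus 2 L)), v ∈ szSector (Λ := FermionTorus 2 L) (N L - 2) 0 →
                hubbardTorus 2 L 1 U *ᵥ v =
                  (((hubbardTorus 2 L 1 U).minEnergyOn (szSector (Λ := FermionTorus 2 L) (N L) 0) - U : ℝ) : ℂ) •
                    v →
                  star v ⬝ᵥ (pairField sWave L *ᵥ ψ L) = 0) ∧
              ∀ φ : Fock (Orb (FermionTorus 2 L)), IsGroundStateInSector (hubbardTorus 2 L 1 U) (N L) 0 φ →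
                star (etaLower torusStagger *ᵥ φ) ⬝ᵥ (pairField sWave L *ᵥ ψ L) = 0 :=
  Summit.HubbardSuperconductivity.HubbardSuperconductivity.Theorems.NoOnsiteODLRO.Negative.shiftedInfraredBound_forces_kernel_orthogonality
    h

/-- **When the hidden assertion is live**: at even side `L` with `2n + 2 ≤ L²`, `ker K₋ ∩ szSector (2n) 0 ≠ 0` IFF
the pair window at `N = 2n + 2` is CLOSED, `E(2n,0) = E(2n+2,0) − U` — then the kernel is the whole ground space of
the lower sector (landed, `Negative.closedWindow_iff_exists_zeroMode`; Yang's `E(2n+2,0) ≤ E(2n,0) + U` plus the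
variational principle). Yang, PRL 63 (1989) 2144; Tasaki (2020) §2.2. [folklore] -/
theorem closedWindow_iff_exists_zeroMode {L : ℕ} (hL : Even L) (U : ℝ) {n : ℕ} (hn : 2 * n + 2 ≤ L ^ 2) :
    (hubbardTorus 2 L 1 U).minEnergyOn (szSector (Λ := FermionTorus 2 L) (2 * n) 0) =
        (hubbardTorus 2 L 1 U).minEnergyOn (szSector (Λ := FermionTorus 2 L) (2 * n + 2) 0) - U ↔
      ∃ v ∈ szSector (Λ := FermionTorus 2 L) (2 * n) 0, v ≠ 0 ∧
        hubbardTorus 2 L 1 U *ᵥ v =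
          (((hubbardTorus 2 L 1 U).minEnergyOn (szSector (Λ := FermionTorus 2 L) (2 * n + 2) 0) - U : ℝ) : ℂ) • v :=
  Summit.HubbardSuperconductivity.HubbardSuperconductivity.Theorems.NoOnsiteODLRO.Negative.closedWindow_iff_exists_zeroMode
    hL U hn

/-- The precise FAILURE HYPOTHESIS of the stub (not constructible here: it speaks about exact ground states at
large `L` on the closed-window branch): for some `U > 0`, `δ ∈ (0,1/2)` and some admissible sequence, frequently in
even `L` a zero mode of `K₋` in the pair-removed sector overlaps `P_s ψ_L` (e.g. a momentum-mixed degenerate ground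
space `{ψ_{(π,0)}, ψ_{(0,π)}}`, whose members differ by `Q = (π,π)`, the momentum carried by `η_Q† η₀`). [folklore] -/
def KernelOverlapAlongSomeSequence : Prop :=
  ∃ (U δ : ℝ), 0 < U ∧ δ ∈ Set.Ioo (0 : ℝ) (1 / 2) ∧
    ∃ (N : ℕ → ℕ) (ψ : ∀ L, Fock (Orb (FermionTorus 2 L))),
      (∀ L, Even L → N L = 2 * ⌊(1 - δ) * (L : ℝ) ^ 2 / 2⌋₊ ∧ star (ψ L) ⬝ᵥ ψ L = 1 ∧
          IsGroundStateInSector (hubbardTorus 2 L 1 U) (N L) 0 (ψ L)) ∧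
        ∀ L₀ : ℕ, ∃ (L : ℕ) (_ : NeZero L), Even L ∧ L₀ ≤ L ∧
          ∃ v ∈ szSector (Λ := FermionTorus 2 L) (N L - 2) 0,
            hubbardTorus 2 L 1 U *ᵥ v =
                (((hubbardTorus 2 L 1 U).minEnergyOn (szSector (Λ := FermionTorus 2 L) (N L) 0) - U : ℝ) : ℂ) •
                  v ∧
              star v ⬝ᵥ (pairField sWave L *ᵥ ψ L) ≠ 0

/-- **Conditional kill of the stub** (landed, `Negative.shiftedInfraredBound_false_of_kernelOverlap`): a kernel
overlap frequently in `L` refutes `stub_shiftedInfraredBound` for EVERY prefactor, while the crux `NoOnsiteODLRO`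
is insensitive to it — the stub is strictly more exposed than the crux exactly on the closed-window branch
(lead's risk (a), `PICKED.md`, made precise). Not a refutation: the hypothesis is as unconstructible as a
counterexample to the crux itself. [folklore] -/
theorem stubShiftedInfraredBound_false_of_kernelOverlap :
    KernelOverlapAlongSomeSequence → ¬ StubShiftedInfraredBound :=
  Summit.HubbardSuperconductivity.HubbardSuperconductivity.Theorems.NoOnsiteODLRO.Negative.shiftedInfraredBound_false_of_kernelOverlap

end Summit.HubbardSuperconductivity.HubbardSuperconductivity.Cruxes.NoOnsiteODLRO.Disproof

end
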